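import Summits.QuantumFields.BalabanUV.Beta.EriceFlowEnclosureB12AsPrintedHistoryContagionShiftFlowZeroTangentLambda
import Mathlib.Analysis.Calculus.ContDiff.Deriv

/-!
# Beta / EriceFlowEnclosureB12AsPrintedHistoryContagionShiftFlowZeroTangentSmooth — ASYMPTOTIC FREEDOM IS CONTAGIOUS, part 71: C¹ MEMORY, C¹ Λ-COORDINATE.  FOR THE FLOW
# (part 14's package at e′) under part 68's C¹ shape COMPLETED BY THE CONTINUITY LETTER OF THE GRADIENT (`hGc`: **`∀ ε > 0 ∃ ρ > 0: sup_j |u′_j − u_j| ≤ ρ ⟹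
# |G u′ j − G u j| ≤ ε·θ^j`** on the box — uniform continuity of the gradient in the profile sense; def-free, an explicit binder): (§120) THE TANGENT FLOW IS CONTINUOUS IN
# THE PIN, UNIFORMLY IN THE SCALE — for two pins e, ẽ of ]0, e′] with `(16∕3)e′³|1∕ẽ² − 1∕e²| ≤ ρ` the tangent flows satisfy **`|W̃_k − W_k| ≤ (8∕7)·S·ε∕(1−θ) +
# (16∕7)·e′²·|1∕ẽ² − 1∕e²|` for every k** (`S = 8e′³ + 16e′∕β*`; part 66's `fixedPoint_perturb` a third time: gradients ε-close at the two families of tails, Jacobians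
# `h̃³∕2`, `h³∕2` profile-close), hence so are their ultraviolet limits (§121); (§122) for every dynamical Abel function Λ: **`deriv Λ` IS CONTINUOUS ON ]0, e′[** and
# **`ContDiffOn ℝ 1 Λ (Ioo 0 e′)`** — and part 60's (#73g) ABSTRACT SMOOTH THEORY IS INHABITED BY THE FLOW: its hypothesis `hD : ∀ x ∈ ]0, e′[, HasDerivAt Λ (D x) x` holds with
# `D = deriv Λ`, CONTINUOUS (`smooth_hypotheses_of_flow`).  With gen 41 this closes the dichotomy on node U2's class: Lipschitz memory ⟹ a velocity at almost every scale and
# not better (#73i∕j); C¹ memory ⟹ a C¹ Λ-coordinate and (part 72) a Gell-Mann–Low equation at every scale with a continuous β-function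
# (β-flow team, prover 1, unit `b2b-balaban-beta-bflow-p1`, gen 42; ROW AP-I·Uc × NODE U2)

HONEST FRAMING (page 1 of everything the β sub-cell writes): discharging `BetaPertH` makes Bałaban's UV stability UNCONDITIONAL — a
real constructive-QFT result; it is NOT the continuum limit and NOT the Clay problem.  HONEST DEPENDENCY (cell reorg 2026-08-19,
verbatim): «continuum YM on T⁴ ⇐ BetaPertH ∧ nine spine estimates (0/9 proved); BetaPertH ⇐ (D1) ∧ (D4) ∧ CAP+tail; G-an2-4 gates
asym, D1 and NE2/3/4.»  THIS MODULE DISCHARGES NOTHING: [folklore] real analysis (parts 66–70 by name; ε–δ continuity; Mathlib's `contDiffOn_succ_iff_deriv_of_isOpen`) over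
node U2's HYPOTHESIS SHAPES `T4BetaStationary.{SeqBox, MemoryProfile}`, `T4BetaFlowWellPosed.{MemFlow, solution}` consumed BY NAME (NOT PRINTED for [I] = T. Bałaban, Commun.
Math. Phys. **109** (1987) [Balaban1987RG1]: p. 298 says only that β_j depends on the preceding couplings; (0.20) p. 256; Theorem 2 (0.31) p. 259 STATED WITHOUT PROOF).  The
C¹ shape (`hG`, `hGB`, `hGc`) is OUR explicit binder.  Nothing of Bałaban's β is asserted.

WHAT THIS FILE PROVES (0 sorry, 0 def): §120 `abs_cube_sub_cube_le`, **`tangent_sub_tangent_abs_le`**, **`tangent_continuous_uniform`**; §121 **`tangentLimit_continuous`**;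
§122 `chartFactor_continuousAt`, **`deriv_dynAbel_continuousAt`**, **`deriv_dynAbel_continuousOn`**, **`contDiffOn_dynAbel`**, **`smooth_hypotheses_of_flow`**.  NOT CLAIMED:
second derivatives; anything about Bałaban's β; `BetaPertH`; the continuum limit of the measures; Clay.
-/

namespace Summit.QuantumFields.BalabanUV.Beta.EriceFlowEnclosureB12AsPrintedHistoryContagionShiftFlowZeroTangentSmooth

open Finset Filter Topology Set
open Literature.MathematicalPhysics.QuantumFieldTheory.Balaban1983to89
open Literature.MathematicalPhysics.QuantumFieldTheory.Balaban1983to89.T4CouplingMatching (prof sprof sprof_pos sprof_sq prof_pos sprof_zero)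
open Literature.MathematicalPhysics.QuantumFieldTheory.Balaban1983to89.T4BetaStationary (SeqBox MemoryProfile)
open Literature.MathematicalPhysics.QuantumFieldTheory.Balaban1983to89.T4BetaFlowWellPosed (MemFlow drive solution seqBox_shift invSq_eq_of_memFlow)
open Summit.QuantumFields.BalabanUV.Beta.EriceFlowEnclosureB12AsPrintedHistoryContagionShiftFlowZeroTangent (fixedPoint_perturb)
open Summit.QuantumFields.BalabanUV.Beta.EriceFlowEnclosureB12AsPrintedHistoryContagionShiftFlowZeroTangentLimit (profWeight_nonneg profWeight_anti
  sum_profWeight_le)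
open Summit.QuantumFields.BalabanUV.Beta.EriceFlowEnclosureB12AsPrintedHistoryContagionShiftFlowZeroTangentFlow (solution_facts tangent_data smallness_of_hs5
  tangent_exists)
open Summit.QuantumFields.BalabanUV.Beta.EriceFlowEnclosureB12AsPrintedHistoryContagionShiftFlowZeroTangentDeriv (invSq_sub_ne_zero abs_sub_pins_le_of_quotient
  invSq_sub_invSq_tendsto_zero)
open Summit.QuantumFields.BalabanUV.Beta.EriceFlowEnclosureB12AsPrintedHistoryContagionShiftFlowZeroTangentLambda (tangentLimit_exists hasDerivAt_dynAbel
  differentiableAt_dynAbel deriv_dynAbel_eq differentiableOn_dynAbel)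

noncomputable section

/-! ## §120 The tangent flow is continuous in the pin, uniformly in the scale -/

/-- Cubes of two couplings below a common profile value σ: `|b³ − a³| ≤ 3σ²·|b − a|`. [folklore] -/
theorem abs_cube_sub_cube_le {σ a b : ℝ} (ha : 0 < a) (hb : 0 < b) (haσ : a ≤ σ) (hbσ : b ≤ σ) :
    |b ^ 3 / 2 - a ^ 3 / 2| ≤ 3 / 2 * σ ^ 2 * |b - a| := by
  have e : b ^ 3 / 2 - a ^ 3 / 2 = (b - a) * ((b ^ 2 + b * a + a ^ 2) / 2) := by ring
  rw [e, abs_mul, abs_of_nonneg (by positivity : (0:ℝ) ≤ (b ^ 2 + b * a + a ^ 2) / 2)]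
  have h3 : (b ^ 2 + b * a + a ^ 2) / 2 ≤ 3 / 2 * σ ^ 2 := by nlinarith [mul_le_mul hbσ haσ ha.le (ha.le.trans haσ)]
  nlinarith [abs_nonneg (b - a)]

/-- **THE TANGENT FLOWS AT TWO PINS, AT EVERY SCALE AT ONCE.**  Part 14's package at e′; the gradient profile `hG`; an ε-instance of the continuity letter of the gradient at
sup-distance ρ, in RELATIVE form `|G u′ j − G u j| ≤ ε·C_mθ^j` (the absolute letter gives it with ε∕C_m when C_m > 0, and trivially when C_m = 0); pins e, ẽ of ]0, e′] with
`(16∕3)e′³|1∕ẽ² − 1∕e²| ≤ ρ`; W, W̃ their tangent flows (`|W|, |W̃| ≤ 2`).  THEN for every k: **`|W̃_k − W_k| ≤ (2∕7)·ε + (16∕7)·e′²·|1∕ẽ² − 1∕e²|`** — part 66's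
`fixedPoint_perturb` with σ₁ = 0 and kernels profile-close with `η = ε∕2 + 4e′²|1∕ẽ² − 1∕e²|`. [cite: Balaban1987RG1, Thm 2 (0.31) p.259 with (0.20) p.256 and p.298] -/
theorem tangent_sub_tangent_abs_le {B : (ℕ → ℝ) → ℝ} {G : (ℕ → ℝ) → ℕ → ℝ} {Cm θ γ bs ta gs e' ε ρ : ℝ} {t W WW : ℕ → ℝ}
    (hB : MemoryProfile Cm θ γ B) (hCm : 0 ≤ Cm) (hθ0 : 0 ≤ θ) (hθ1 : θ < 1) (hbs : 0 < bs) (hta : 0 < ta)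
    (hts : SeqBox γ t) (htf : MemFlow B gs t) (hprof : ∀ m : ℕ, 1 / ta ^ 2 + bs * (m : ℝ) ≤ 1 / (t m) ^ 2)
    (hG : ∀ u : ℕ → ℝ, SeqBox γ u → ∀ j, |G u j| ≤ Cm * θ ^ j) (hε : 0 ≤ ε)
    (hcont : ∀ u u' : ℕ → ℝ, SeqBox γ u → SeqBox γ u' → (∀ j, |u' j - u j| ≤ ρ) → ∀ j, |G u' j - G u j| ≤ ε * (Cm * θ ^ j))
    (h2e' : 2 * e' ≤ γ) (hs1 : 4 * Cm * e' ≤ bs * (1 - θ))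
    (hs2 : e' ^ 2 * (1 / gs ^ 2 + Cm * γ / (1 - θ) ^ 2 + (2 * Cm / ((1 - θ) * bs)) ^ 2) ≤ 3 / 4)
    (hs4 : 64 * Cm * e' ^ 3 ≤ (1 - θ) ^ 2) (hs5 : Cm * (8 * e' ^ 3 + 16 * e' / bs) ≤ (1 - θ) / 4)
    {e ee : ℝ} (he : e ∈ Ioc (0 : ℝ) e') (hee : ee ∈ Ioc (0 : ℝ) e') (hρ : 16 / 3 * e' ^ 3 * |1 / ee ^ 2 - 1 / e ^ 2| ≤ ρ)
    (hW : ∀ k, W k = 1 - ∑ p ∈ range k, ∑' j, G (fun i => solution B e (p + 1 + i)) j * ((solution B e (p + 1 + j)) ^ 3 / 2) * W (p + 1 + j))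
    (hWM : ∀ k, |W k| ≤ 2)
    (hWW : ∀ k, WW k = 1 - ∑ p ∈ range k, ∑' j, G (fun i => solution B ee (p + 1 + i)) j * ((solution B ee (p + 1 + j)) ^ 3 / 2) * WW (p + 1 + j))
    (hWWM : ∀ k, |WW k| ≤ 2) (k : ℕ) :
    |WW k - W k| ≤ 2 / 7 * ε + 16 / 7 * e' ^ 2 * |1 / ee ^ 2 - 1 / e ^ 2| := by
  have he' : 0 < e' := he.1.trans_le he.2
  have h1θ : 0 < 1 - θ := by linarith
  set S : ℝ := 8 * e' ^ 3 + 16 * e' / bs with hS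
  set δ : ℝ := 1 / ee ^ 2 - 1 / e ^ 2 with hδ
  set h : ℕ → ℝ := solution B e with hdef
  set hh : ℕ → ℝ := solution B ee with hhdef
  set w : ℕ → ℝ := fun q => 1 / (sprof (2 * e') (bs / 4) q) ^ 2 * (1 / sprof (2 * e') (bs / 4) q) with hw
  obtain ⟨hsb, -, -, hle, -, hcube⟩ := solution_facts hB hCm hθ0 hθ1 hbs hta hts htf hprof h2e' hs1 hs2 hs4 hs5 he
  obtain ⟨hsbb, -, -, hlee, -, hcubee⟩ := solution_facts hB hCm hθ0 hθ1 hbs hta hts htf hprof h2e' hs1 hs2 hs4 hs5 hee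
  obtain ⟨hc, hv⟩ := tangent_data (B := B) (e' := e') hG hsb hcube
  obtain ⟨hcc, hvv⟩ := tangent_data (B := B) (e' := e') hG hsbb hcubee
  obtain ⟨hq8, hq, hq4⟩ := smallness_of_hs5 (Cm := Cm) (bs := bs) (e' := e') hθ1 hs5
  have hw0 : ∀ q, 0 ≤ w q := profWeight_nonneg hbs he'
  have hwanti : ∀ {a b : ℕ}, a ≤ b → w b ≤ w a := fun hab => profWeight_anti hbs he' hab
  have hwS : ∀ m, ∑ q ∈ range (m + 1), w q ≤ S := sum_profWeight_le hbs he'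
  have hS0 : 0 < S := by positivity
  -- the coupling separation: zero if the pins coincide, else part 69's bound
  have hd : ∀ q, |hh q - h q| ≤ 2 / 3 * w q * |δ| ∧ |hh q - h q| ≤ ρ := by
    intro q
    rcases eq_or_ne ee e with heq | hne
    · have h0 : hh q - h q = 0 := by rw [hhdef, hdef, heq]; ring
      have hρ0 : 0 ≤ ρ := le_trans (by positivity) hρ
      rw [h0, abs_zero]
      exact ⟨by have := hw0 q; positivity, hρ0⟩
    · have h1 := abs_sub_pins_le_of_quotient hB hCm hθ0 hθ1 hbs hta hts htf hprof h2e' hs1 hs2 hs4 hs5 he hee hne q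
      exact ⟨h1.1, h1.2.trans hρ⟩
  -- the kernel difference in part 66's profile form, η = ε/2 + 4e′²|δ|
  have hE : ∀ p j, |G (fun i => hh (p + 1 + i)) j * (hh (p + 1 + j) ^ 3 / 2) - G (fun i => h (p + 1 + i)) j * (h (p + 1 + j) ^ 3 / 2)|
      ≤ Cm * θ ^ j * (w (p + 1 + j) * (ε / 2 + 4 * e' ^ 2 * |δ|)) := by
    intro p j
    set q := p + 1 + j with hq'
    have hsep : ∀ i, |hh (p + 1 + i) - h (p + 1 + i)| ≤ ρ := fun i => (hd _).2
    have hGd := hcont (fun i => h (p + 1 + i)) (fun i => hh (p + 1 + i)) (seqBox_shift hsb (p + 1)) (seqBox_shift hsbb (p + 1)) hsep j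
    have hcub := abs_cube_sub_cube_le (hsb q).1 (hsbb q).1 (hle q) (hlee q)
    have hσ : (1 / sprof (2 * e') (bs / 4) q) ^ 2 ≤ (2 * e') ^ 2 := by
      have hp := sprof_pos (by positivity : (0:ℝ) < 2 * e') (by positivity : (0:ℝ) ≤ bs / 4)
      have h1 : 1 / sprof (2 * e') (bs / 4) q ≤ 1 / sprof (2 * e') (bs / 4) 0 :=
        one_div_le_one_div_of_le (hp 0) (EriceFlowEnclosureB12AsPrintedHistoryContagion.sprof_le_sprof (by positivity) (Nat.zero_le q))
      rw [sprof_zero (by positivity : (0:ℝ) < 2 * e'), one_div_one_div] at h1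
      exact pow_le_pow_left₀ (one_div_pos.mpr (hp q)).le h1 2
    have hvv' : |hh q ^ 3 / 2 - h q ^ 3 / 2| ≤ 4 * e' ^ 2 * (w q * |δ|) := by
      calc |hh q ^ 3 / 2 - h q ^ 3 / 2| ≤ 3 / 2 * (1 / sprof (2 * e') (bs / 4) q) ^ 2 * |hh q - h q| := hcub
        _ ≤ 3 / 2 * (2 * e') ^ 2 * (2 / 3 * w q * |δ|) :=
            mul_le_mul (mul_le_mul_of_nonneg_left hσ (by norm_num)) (hd q).1 (abs_nonneg _) (by positivity)
        _ = 4 * e' ^ 2 * (w q * |δ|) := by ring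
    have esplit : G (fun i => hh (p + 1 + i)) j * (hh q ^ 3 / 2) - G (fun i => h (p + 1 + i)) j * (h q ^ 3 / 2)
        = (G (fun i => hh (p + 1 + i)) j - G (fun i => h (p + 1 + i)) j) * (hh q ^ 3 / 2)
          + G (fun i => h (p + 1 + i)) j * (hh q ^ 3 / 2 - h q ^ 3 / 2) := by ring
    rw [esplit]
    have hw2 : |hh q ^ 3 / 2| ≤ w q / 2 := hvv q
    calc _ ≤ |(G (fun i => hh (p + 1 + i)) j - G (fun i => h (p + 1 + i)) j) * (hh q ^ 3 / 2)|
          + |G (fun i => h (p + 1 + i)) j * (hh q ^ 3 / 2 - h q ^ 3 / 2)| := abs_add_le _ _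
      _ ≤ ε * (Cm * θ ^ j) * (w q / 2) + Cm * θ ^ j * (4 * e' ^ 2 * (w q * |δ|)) := by
          rw [abs_mul, abs_mul]
          exact add_le_add (mul_le_mul hGd hw2 (abs_nonneg _) (by positivity)) (mul_le_mul (hc p j) hvv' (abs_nonneg _) (by positivity))
      _ = Cm * θ ^ j * (w (p + 1 + j) * (ε / 2 + 4 * e' ^ 2 * |δ|)) := by rw [hq']; ring
  have hP := fixedPoint_perturb (c := fun p j => G (fun i => hh (p + 1 + i)) j) (c' := fun p j => G (fun i => h (p + 1 + i)) j)
    (v := fun q => hh q ^ 3 / 2) (v' := fun q => h q ^ 3 / 2) (s := fun _ => (1 : ℝ)) (s' := fun _ => (1 : ℝ)) (W := WW) (W' := W) (σ₁ := 0)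
    hCm hθ0 hθ1 hw0 hwanti hwS hq hcc hvv hc hv hWW hWWM hW hWM (fun k => by simp) (by positivity) hE k
  have hX : Cm * S * ((ε / 2 + 4 * e' ^ 2 * |δ|) * 2) / (1 - θ) ≤ 1 / 4 * ((ε / 2 + 4 * e' ^ 2 * |δ|) * 2) := by
    rw [show Cm * S * ((ε / 2 + 4 * e' ^ 2 * |δ|) * 2) / (1 - θ) = Cm * S / (1 - θ) * ((ε / 2 + 4 * e' ^ 2 * |δ|) * 2) by ring]
    exact mul_le_mul_of_nonneg_right hq4 (by positivity)
  have hnum : 0 ≤ 0 + Cm * S * ((ε / 2 + 4 * e' ^ 2 * |δ|) * 2) / (1 - θ) := by positivity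
  have hden : 7 / 8 ≤ 1 - Cm * S / (2 * (1 - θ)) := by linarith
  calc |WW k - W k| ≤ (0 + Cm * S * ((ε / 2 + 4 * e' ^ 2 * |δ|) * 2) / (1 - θ)) / (1 - Cm * S / (2 * (1 - θ))) := hP
    _ ≤ (0 + Cm * S * ((ε / 2 + 4 * e' ^ 2 * |δ|) * 2) / (1 - θ)) / (7 / 8) := div_le_div_of_nonneg_left hnum (by norm_num) hden
    _ ≤ 2 / 7 * ε + 16 / 7 * e' ^ 2 * |δ| := by rw [div_eq_inv_mul]; norm_num; nlinarith [abs_nonneg δ]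

/-- **THE TANGENT FLOW IS CONTINUOUS IN THE PIN, UNIFORMLY IN THE SCALE**: under the gradient profile `hG` and the continuity letter `hGc`, for an interior pin e with tangent
flow W and every ε₀ > 0: for all ẽ close to e, EVERY tangent flow W̃ at ẽ (eq + `|W̃| ≤ 2`) satisfies **`|W̃_k − W_k| ≤ ε₀` for every k**.
[cite: Balaban1987RG1, Thm 2 (0.31) p.259 with (0.20) p.256 and p.298] -/
theorem tangent_continuous_uniform {B : (ℕ → ℝ) → ℝ} {G : (ℕ → ℝ) → ℕ → ℝ} {Cm θ γ bs ta gs e' : ℝ} {t W : ℕ → ℝ}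
    (hB : MemoryProfile Cm θ γ B) (hCm : 0 ≤ Cm) (hθ0 : 0 ≤ θ) (hθ1 : θ < 1) (hbs : 0 < bs) (hta : 0 < ta)
    (hts : SeqBox γ t) (htf : MemFlow B gs t) (hprof : ∀ m : ℕ, 1 / ta ^ 2 + bs * (m : ℝ) ≤ 1 / (t m) ^ 2)
    (hG : ∀ u : ℕ → ℝ, SeqBox γ u → ∀ j, |G u j| ≤ Cm * θ ^ j)
    (hGc : ∀ ε > 0, ∃ ρ > 0, ∀ u u' : ℕ → ℝ, SeqBox γ u → SeqBox γ u' → (∀ j, |u' j - u j| ≤ ρ) → ∀ j, |G u' j - G u j| ≤ ε * θ ^ j)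
    (h2e' : 2 * e' ≤ γ) (hs1 : 4 * Cm * e' ≤ bs * (1 - θ))
    (hs2 : e' ^ 2 * (1 / gs ^ 2 + Cm * γ / (1 - θ) ^ 2 + (2 * Cm / ((1 - θ) * bs)) ^ 2) ≤ 3 / 4)
    (hs4 : 64 * Cm * e' ^ 3 ≤ (1 - θ) ^ 2) (hs5 : Cm * (8 * e' ^ 3 + 16 * e' / bs) ≤ (1 - θ) / 4) {e : ℝ} (he : e ∈ Ioo (0 : ℝ) e')
    (hW : ∀ k, W k = 1 - ∑ p ∈ range k, ∑' j, G (fun i => solution B e (p + 1 + i)) j * ((solution B e (p + 1 + j)) ^ 3 / 2) * W (p + 1 + j))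
    (hWM : ∀ k, |W k| ≤ 2) {ε₀ : ℝ} (hε₀ : 0 < ε₀) :
    ∀ᶠ ee in 𝓝 e, ee ∈ Ioc (0 : ℝ) e' ∧ ∀ WW : ℕ → ℝ,
      (∀ k, WW k = 1 - ∑ p ∈ range k, ∑' j, G (fun i => solution B ee (p + 1 + i)) j * ((solution B ee (p + 1 + j)) ^ 3 / 2) * WW (p + 1 + j)) →
      (∀ k, |WW k| ≤ 2) → ∀ k, |WW k - W k| ≤ ε₀ := by
  have he' : 0 < e' := he.1.trans he.2
  have hec : e ∈ Ioc (0 : ℝ) e' := ⟨he.1, he.2.le⟩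
  -- a relative-continuity instance with ε = ε₀: trivial if C_m = 0, else the letter at ε₀·C_m
  have hinst : ∃ ρ > 0, ∀ u u' : ℕ → ℝ, SeqBox γ u → SeqBox γ u' → (∀ j, |u' j - u j| ≤ ρ) → ∀ j, |G u' j - G u j| ≤ ε₀ * (Cm * θ ^ j) := by
    rcases eq_or_lt_of_le hCm with h0 | hpos
    · refine ⟨1, one_pos, fun u u' hu hu' _ j => ?_⟩
      have hz : ∀ v : ℕ → ℝ, SeqBox γ v → G v j = 0 := fun v hv => by
        have := hG v hv j; rw [← h0, zero_mul] at this; exact abs_nonpos_iff.mp this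
      rw [hz u hu, hz u' hu', sub_zero, abs_zero, ← h0]; simp
    · obtain ⟨ρ, hρ, hc⟩ := hGc (ε₀ * Cm) (by positivity)
      exact ⟨ρ, hρ, fun u u' hu hu' hsep j => by have := hc u u' hu hu' hsep j; linarith [this, show ε₀ * Cm * θ ^ j = ε₀ * (Cm * θ ^ j) by ring]⟩
  obtain ⟨ρ, hρ, hcont⟩ := hinst
  have hsmall : ∀ᶠ ee in 𝓝 e, |1 / ee ^ 2 - 1 / e ^ 2| < min (3 * ρ / (16 * e' ^ 3)) (ε₀ / (4 * e' ^ 2)) := by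
    have h := invSq_sub_invSq_tendsto_zero he.1.ne'
    have hpos : 0 < min (3 * ρ / (16 * e' ^ 3)) (ε₀ / (4 * e' ^ 2)) := by positivity
    have := (Metric.tendsto_nhds.1 h) _ hpos
    refine this.mono fun ee hee => ?_
    rwa [Real.dist_eq, sub_zero] at hee
  have hmem : ∀ᶠ ee in 𝓝 e, ee ∈ Ioc (0 : ℝ) e' := Filter.eventually_of_mem (Ioo_mem_nhds he.1 he.2) fun x hx => ⟨hx.1, hx.2.le⟩
  filter_upwards [hsmall, hmem] with ee hsm hee
  refine ⟨hee, fun WW hWW hWWM k => ?_⟩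
  have hsm1 : |1 / ee ^ 2 - 1 / e ^ 2| < 3 * ρ / (16 * e' ^ 3) := hsm.trans_le (min_le_left _ _)
  have hsm2 : |1 / ee ^ 2 - 1 / e ^ 2| < ε₀ / (4 * e' ^ 2) := hsm.trans_le (min_le_right _ _)
  have hρ' : 16 / 3 * e' ^ 3 * |1 / ee ^ 2 - 1 / e ^ 2| ≤ ρ := by
    have := (lt_div_iff₀ (by positivity : (0:ℝ) < 16 * e' ^ 3)).mp hsm1
    linarith
  have hmain := tangent_sub_tangent_abs_le (ε := ε₀) hB hCm hθ0 hθ1 hbs hta hts htf hprof hG hε₀.le hcont h2e' hs1 hs2 hs4 hs5 hec hee hρ' hW hWM hWW hWWM k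
  have h2 : 16 / 7 * e' ^ 2 * |1 / ee ^ 2 - 1 / e ^ 2| ≤ 4 / 7 * ε₀ := by
    have := (lt_div_iff₀ (by positivity : (0:ℝ) < 4 * e' ^ 2)).mp hsm2
    nlinarith [sq_nonneg e']
  linarith

/-! ## §121 The ultraviolet limit of the tangent flow is continuous in the pin -/

/-- **`W_∞` IS CONTINUOUS IN THE PIN**: for an interior pin e (tangent flow W, limit W_∞) and every ε₀ > 0, for all ẽ close to e, every tangent flow at ẽ with any ultraviolet
limit W̃_∞ has `|W̃_∞ − W_∞| ≤ ε₀`. [cite: Balaban1987RG1, Thm 2 (0.31) p.259 with (0.20) p.256 and p.298] -/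
theorem tangentLimit_continuous {B : (ℕ → ℝ) → ℝ} {G : (ℕ → ℝ) → ℕ → ℝ} {Cm θ γ bs ta gs e' : ℝ} {t W : ℕ → ℝ}
    (hB : MemoryProfile Cm θ γ B) (hCm : 0 ≤ Cm) (hθ0 : 0 ≤ θ) (hθ1 : θ < 1) (hbs : 0 < bs) (hta : 0 < ta)
    (hts : SeqBox γ t) (htf : MemFlow B gs t) (hprof : ∀ m : ℕ, 1 / ta ^ 2 + bs * (m : ℝ) ≤ 1 / (t m) ^ 2)
    (hG : ∀ u : ℕ → ℝ, SeqBox γ u → ∀ j, |G u j| ≤ Cm * θ ^ j)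
    (hGc : ∀ ε > 0, ∃ ρ > 0, ∀ u u' : ℕ → ℝ, SeqBox γ u → SeqBox γ u' → (∀ j, |u' j - u j| ≤ ρ) → ∀ j, |G u' j - G u j| ≤ ε * θ ^ j)
    (h2e' : 2 * e' ≤ γ) (hs1 : 4 * Cm * e' ≤ bs * (1 - θ))
    (hs2 : e' ^ 2 * (1 / gs ^ 2 + Cm * γ / (1 - θ) ^ 2 + (2 * Cm / ((1 - θ) * bs)) ^ 2) ≤ 3 / 4)
    (hs4 : 64 * Cm * e' ^ 3 ≤ (1 - θ) ^ 2) (hs5 : Cm * (8 * e' ^ 3 + 16 * e' / bs) ≤ (1 - θ) / 4) {e : ℝ} (he : e ∈ Ioo (0 : ℝ) e')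
    (hW : ∀ k, W k = 1 - ∑ p ∈ range k, ∑' j, G (fun i => solution B e (p + 1 + i)) j * ((solution B e (p + 1 + j)) ^ 3 / 2) * W (p + 1 + j))
    (hWM : ∀ k, |W k| ≤ 2) {Winf : ℝ} (hWinf : Tendsto W atTop (𝓝 Winf)) {ε₀ : ℝ} (hε₀ : 0 < ε₀) :
    ∀ᶠ ee in 𝓝 e, ee ∈ Ioc (0 : ℝ) e' ∧ ∀ WW : ℕ → ℝ,
      (∀ k, WW k = 1 - ∑ p ∈ range k, ∑' j, G (fun i => solution B ee (p + 1 + i)) j * ((solution B ee (p + 1 + j)) ^ 3 / 2) * WW (p + 1 + j)) →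
      (∀ k, |WW k| ≤ 2) → ∀ WWinf : ℝ, Tendsto WW atTop (𝓝 WWinf) → |WWinf - Winf| ≤ ε₀ := by
  have h := tangent_continuous_uniform hB hCm hθ0 hθ1 hbs hta hts htf hprof hG hGc h2e' hs1 hs2 hs4 hs5 he hW hWM hε₀
  refine h.mono fun ee hee => ⟨hee.1, fun WW hWW hWWM WWinf hT => ?_⟩
  exact le_of_tendsto ((continuous_abs.tendsto _).comp (hT.sub hWinf)) (Eventually.of_forall (hee.2 WW hWW hWWM))

/-! ## §122 The derivative of a dynamical Abel function is continuous: Λ ∈ C¹(]0, e′[) -/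

/-- The chart factor `x ↦ −2∕x³` is continuous away from 0. [folklore] -/
theorem chartFactor_continuousAt {e : ℝ} (he : e ≠ 0) : ContinuousAt (fun x : ℝ => -2 / x ^ 3) e :=
  continuousAt_const.div (continuousAt_id.pow 3) (pow_ne_zero 3 he)

/-- **`deriv Λ` IS CONTINUOUS AT EVERY INTERIOR COUPLING** (every dynamical Abel function Λ of the flow, under `hG`, `hGB`, `hGc`): `deriv Λ x = W_∞(x)·(−2∕x³)` near e with
`W_∞(x) = (−x³∕2)·deriv Λ x` continuous at e by §121. [cite: Balaban1987RG1, Thm 2 (0.31) p.259 with (0.20) p.256 and p.298] -/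
theorem deriv_dynAbel_continuousAt {B : (ℕ → ℝ) → ℝ} {G : (ℕ → ℝ) → ℕ → ℝ} {Cm θ γ bs ta gs e' : ℝ} {t : ℕ → ℝ} {a : ℕ → ℝ} {Λ : ℝ → ℝ}
    (hB : MemoryProfile Cm θ γ B) (hCm : 0 ≤ Cm) (hθ0 : 0 ≤ θ) (hθ1 : θ < 1) (hbs : 0 < bs) (hta : 0 < ta)
    (hts : SeqBox γ t) (htf : MemFlow B gs t) (hprof : ∀ m : ℕ, 1 / ta ^ 2 + bs * (m : ℝ) ≤ 1 / (t m) ^ 2)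
    (hG : ∀ u : ℕ → ℝ, SeqBox γ u → ∀ j, |G u j| ≤ Cm * θ ^ j)
    (hGB : ∀ ε > 0, ∃ ρ > 0, ∀ u u' : ℕ → ℝ, SeqBox γ u → SeqBox γ u' → (∀ j, |u' j - u j| ≤ ρ) →
      |B u' - B u - ∑' j, G u j * (u' j - u j)| ≤ ε * ∑' j, θ ^ j * |u' j - u j|)
    (hGc : ∀ ε > 0, ∃ ρ > 0, ∀ u u' : ℕ → ℝ, SeqBox γ u → SeqBox γ u' → (∀ j, |u' j - u j| ≤ ρ) → ∀ j, |G u' j - G u j| ≤ ε * θ ^ j)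
    (hΛ : ∀ e ∈ Ioc (0 : ℝ) e', ∀ h : ℕ → ℝ, SeqBox γ h → MemFlow B e h → Tendsto (fun n => 1 / h n ^ 2 - a n) atTop (𝓝 (Λ e)))
    (h2e' : 2 * e' ≤ γ) (hs1 : 4 * Cm * e' ≤ bs * (1 - θ))
    (hs2 : e' ^ 2 * (1 / gs ^ 2 + Cm * γ / (1 - θ) ^ 2 + (2 * Cm / ((1 - θ) * bs)) ^ 2) ≤ 3 / 4)
    (hs4 : 64 * Cm * e' ^ 3 ≤ (1 - θ) ^ 2) (hs5 : Cm * (8 * e' ^ 3 + 16 * e' / bs) ≤ (1 - θ) / 4) {e : ℝ} (he : e ∈ Ioo (0 : ℝ) e') :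
    ContinuousAt (deriv Λ) e := by
  have hec : e ∈ Ioc (0 : ℝ) e' := ⟨he.1, he.2.le⟩
  obtain ⟨W, hW, hWM⟩ := tangent_exists hB hCm hθ0 hθ1 hbs hta hts htf hprof hG h2e' hs1 hs2 hs4 hs5 hec
  obtain ⟨Winf, hT, -⟩ := tangentLimit_exists hB hCm hθ0 hθ1 hbs hta hts htf hprof hG h2e' hs1 hs2 hs4 hs5 hec hW hWM
  have hde := (deriv_dynAbel_eq hB hCm hθ0 hθ1 hbs hta hts htf hprof hG hGB hΛ h2e' hs1 hs2 hs4 hs5 he hW hWM hT).1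
  -- F(x) := (−x³/2)·deriv Λ x is continuous at e
  have hF : Tendsto (fun x : ℝ => (-(x ^ 3) / 2) * deriv Λ x) (𝓝 e) (𝓝 Winf) := by
    refine Metric.tendsto_nhds.2 fun ε₀ hε₀ => ?_
    have h := tangentLimit_continuous hB hCm hθ0 hθ1 hbs hta hts htf hprof hG hGc h2e' hs1 hs2 hs4 hs5 he hW hWM hT (half_pos hε₀)
    have hmem : ∀ᶠ x in 𝓝 e, x ∈ Ioo (0 : ℝ) e' := Ioo_mem_nhds he.1 he.2
    filter_upwards [h, hmem] with x hx hxo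
    obtain ⟨WW, hWW, hWWM⟩ := tangent_exists hB hCm hθ0 hθ1 hbs hta hts htf hprof hG h2e' hs1 hs2 hs4 hs5 hx.1
    obtain ⟨WWinf, hTT, -⟩ := tangentLimit_exists hB hCm hθ0 hθ1 hbs hta hts htf hprof hG h2e' hs1 hs2 hs4 hs5 hx.1 hWW hWWM
    have hdx := (deriv_dynAbel_eq hB hCm hθ0 hθ1 hbs hta hts htf hprof hG hGB hΛ h2e' hs1 hs2 hs4 hs5 hxo hWW hWWM hTT).2
    rw [Real.dist_eq, ← hdx]
    exact (hx.2 WW hWW hWWM WWinf hTT).trans_lt (by linarith)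
  have hprod := hF.mul (chartFactor_continuousAt he.1.ne').tendsto
  have hval : Winf * (-2 / e ^ 3) = deriv Λ e := hde.symm
  rw [ContinuousAt, ← hval]
  refine hprod.congr' ?_
  have hmem : ∀ᶠ x in 𝓝 e, x ∈ Ioo (0 : ℝ) e' := Ioo_mem_nhds he.1 he.2
  refine hmem.mono fun x hx => ?_
  have hx3 : x ^ 3 ≠ 0 := pow_ne_zero 3 hx.1.ne'
  show (-(x ^ 3) / 2) * deriv Λ x * (-2 / x ^ 3) = deriv Λ x
  rw [show (-(x ^ 3) / 2) * deriv Λ x * (-2 / x ^ 3) = deriv Λ x * (x ^ 3 / x ^ 3) by ring, div_self hx3, mul_one]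

/-- **`deriv Λ` IS CONTINUOUS ON ]0, e′[.** [cite: Balaban1987RG1, Thm 2 (0.31) p.259 with (0.20) p.256 and p.298] -/
theorem deriv_dynAbel_continuousOn {B : (ℕ → ℝ) → ℝ} {G : (ℕ → ℝ) → ℕ → ℝ} {Cm θ γ bs ta gs e' : ℝ} {t : ℕ → ℝ} {a : ℕ → ℝ} {Λ : ℝ → ℝ}
    (hB : MemoryProfile Cm θ γ B) (hCm : 0 ≤ Cm) (hθ0 : 0 ≤ θ) (hθ1 : θ < 1) (hbs : 0 < bs) (hta : 0 < ta)
    (hts : SeqBox γ t) (htf : MemFlow B gs t) (hprof : ∀ m : ℕ, 1 / ta ^ 2 + bs * (m : ℝ) ≤ 1 / (t m) ^ 2)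
    (hG : ∀ u : ℕ → ℝ, SeqBox γ u → ∀ j, |G u j| ≤ Cm * θ ^ j)
    (hGB : ∀ ε > 0, ∃ ρ > 0, ∀ u u' : ℕ → ℝ, SeqBox γ u → SeqBox γ u' → (∀ j, |u' j - u j| ≤ ρ) →
      |B u' - B u - ∑' j, G u j * (u' j - u j)| ≤ ε * ∑' j, θ ^ j * |u' j - u j|)
    (hGc : ∀ ε > 0, ∃ ρ > 0, ∀ u u' : ℕ → ℝ, SeqBox γ u → SeqBox γ u' → (∀ j, |u' j - u j| ≤ ρ) → ∀ j, |G u' j - G u j| ≤ ε * θ ^ j)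
    (hΛ : ∀ e ∈ Ioc (0 : ℝ) e', ∀ h : ℕ → ℝ, SeqBox γ h → MemFlow B e h → Tendsto (fun n => 1 / h n ^ 2 - a n) atTop (𝓝 (Λ e)))
    (h2e' : 2 * e' ≤ γ) (hs1 : 4 * Cm * e' ≤ bs * (1 - θ))
    (hs2 : e' ^ 2 * (1 / gs ^ 2 + Cm * γ / (1 - θ) ^ 2 + (2 * Cm / ((1 - θ) * bs)) ^ 2) ≤ 3 / 4)
    (hs4 : 64 * Cm * e' ^ 3 ≤ (1 - θ) ^ 2) (hs5 : Cm * (8 * e' ^ 3 + 16 * e' / bs) ≤ (1 - θ) / 4) :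
    ContinuousOn (deriv Λ) (Ioo 0 e') :=
  fun _ hx => (deriv_dynAbel_continuousAt hB hCm hθ0 hθ1 hbs hta hts htf hprof hG hGB hGc hΛ h2e' hs1 hs2 hs4 hs5 hx).continuousWithinAt

/-- **Λ ∈ C¹(]0, e′[)**: every dynamical Abel function of a flow with a C¹ memory functional (gradient with the memory profile, uniform first-order remainder, uniformly
continuous gradient) is continuously differentiable on the open box. [cite: Balaban1987RG1, Thm 2 (0.31) p.259 with (0.20) p.256 and p.298] -/
theorem contDiffOn_dynAbel {B : (ℕ → ℝ) → ℝ} {G : (ℕ → ℝ) → ℕ → ℝ} {Cm θ γ bs ta gs e' : ℝ} {t : ℕ → ℝ} {a : ℕ → ℝ} {Λ : ℝ → ℝ}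
    (hB : MemoryProfile Cm θ γ B) (hCm : 0 ≤ Cm) (hθ0 : 0 ≤ θ) (hθ1 : θ < 1) (hbs : 0 < bs) (hta : 0 < ta)
    (hts : SeqBox γ t) (htf : MemFlow B gs t) (hprof : ∀ m : ℕ, 1 / ta ^ 2 + bs * (m : ℝ) ≤ 1 / (t m) ^ 2)
    (hG : ∀ u : ℕ → ℝ, SeqBox γ u → ∀ j, |G u j| ≤ Cm * θ ^ j)
    (hGB : ∀ ε > 0, ∃ ρ > 0, ∀ u u' : ℕ → ℝ, SeqBox γ u → SeqBox γ u' → (∀ j, |u' j - u j| ≤ ρ) →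
      |B u' - B u - ∑' j, G u j * (u' j - u j)| ≤ ε * ∑' j, θ ^ j * |u' j - u j|)
    (hGc : ∀ ε > 0, ∃ ρ > 0, ∀ u u' : ℕ → ℝ, SeqBox γ u → SeqBox γ u' → (∀ j, |u' j - u j| ≤ ρ) → ∀ j, |G u' j - G u j| ≤ ε * θ ^ j)
    (hΛ : ∀ e ∈ Ioc (0 : ℝ) e', ∀ h : ℕ → ℝ, SeqBox γ h → MemFlow B e h → Tendsto (fun n => 1 / h n ^ 2 - a n) atTop (𝓝 (Λ e)))
    (h2e' : 2 * e' ≤ γ) (hs1 : 4 * Cm * e' ≤ bs * (1 - θ))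
    (hs2 : e' ^ 2 * (1 / gs ^ 2 + Cm * γ / (1 - θ) ^ 2 + (2 * Cm / ((1 - θ) * bs)) ^ 2) ≤ 3 / 4)
    (hs4 : 64 * Cm * e' ^ 3 ≤ (1 - θ) ^ 2) (hs5 : Cm * (8 * e' ^ 3 + 16 * e' / bs) ≤ (1 - θ) / 4) :
    ContDiffOn ℝ 1 Λ (Ioo 0 e') := by
  have hd := (differentiableOn_dynAbel hB hCm hθ0 hθ1 hbs hta hts htf hprof hG hGB hΛ h2e' hs1 hs2 hs4 hs5).1
  have hc := deriv_dynAbel_continuousOn hB hCm hθ0 hθ1 hbs hta hts htf hprof hG hGB hGc hΛ h2e' hs1 hs2 hs4 hs5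
  have h1 : ContDiffOn ℝ (((0 : ℕ) : WithTop ℕ∞) + 1) Λ (Ioo 0 e') := by
    rw [contDiffOn_succ_iff_deriv_of_isOpen isOpen_Ioo]
    exact ⟨hd, fun h => by simp at h, contDiffOn_zero.2 hc⟩
  exact_mod_cast h1

/-- **PART 60's (#73g) SMOOTH THEORY IS INHABITED BY THE FLOW**: under part 14's package, the C¹ shape and part 44's interface, every dynamical Abel function Λ satisfies
`∀ x ∈ ]0, e′[, HasDerivAt Λ (deriv Λ x) x` with `deriv Λ` CONTINUOUS on ]0, e′[ and NEGATIVE — exactly the hypotheses `hD`, `hDc` of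
`…ShiftFlowZeroSemigroupGellMannLowSmooth` with `D = deriv Λ`. [cite: Balaban1987RG1, Thm 2 (0.31) p.259 with (0.20) p.256 and p.298] -/
theorem smooth_hypotheses_of_flow {B : (ℕ → ℝ) → ℝ} {G : (ℕ → ℝ) → ℕ → ℝ} {Cm θ γ bs ta gs e' : ℝ} {t : ℕ → ℝ} {a : ℕ → ℝ} {Λ : ℝ → ℝ}
    (hB : MemoryProfile Cm θ γ B) (hCm : 0 ≤ Cm) (hθ0 : 0 ≤ θ) (hθ1 : θ < 1) (hbs : 0 < bs) (hta : 0 < ta)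
    (hts : SeqBox γ t) (htf : MemFlow B gs t) (hprof : ∀ m : ℕ, 1 / ta ^ 2 + bs * (m : ℝ) ≤ 1 / (t m) ^ 2)
    (hG : ∀ u : ℕ → ℝ, SeqBox γ u → ∀ j, |G u j| ≤ Cm * θ ^ j)
    (hGB : ∀ ε > 0, ∃ ρ > 0, ∀ u u' : ℕ → ℝ, SeqBox γ u → SeqBox γ u' → (∀ j, |u' j - u j| ≤ ρ) →
      |B u' - B u - ∑' j, G u j * (u' j - u j)| ≤ ε * ∑' j, θ ^ j * |u' j - u j|)
    (hGc : ∀ ε > 0, ∃ ρ > 0, ∀ u u' : ℕ → ℝ, SeqBox γ u → SeqBox γ u' → (∀ j, |u' j - u j| ≤ ρ) → ∀ j, |G u' j - G u j| ≤ ε * θ ^ j)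
    (hΛ : ∀ e ∈ Ioc (0 : ℝ) e', ∀ h : ℕ → ℝ, SeqBox γ h → MemFlow B e h → Tendsto (fun n => 1 / h n ^ 2 - a n) atTop (𝓝 (Λ e)))
    (h2e' : 2 * e' ≤ γ) (hs1 : 4 * Cm * e' ≤ bs * (1 - θ))
    (hs2 : e' ^ 2 * (1 / gs ^ 2 + Cm * γ / (1 - θ) ^ 2 + (2 * Cm / ((1 - θ) * bs)) ^ 2) ≤ 3 / 4)
    (hs4 : 64 * Cm * e' ^ 3 ≤ (1 - θ) ^ 2) (hs5 : Cm * (8 * e' ^ 3 + 16 * e' / bs) ≤ (1 - θ) / 4) :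
    (∀ x ∈ Ioo (0 : ℝ) e', HasDerivAt Λ (deriv Λ x) x) ∧ ContinuousOn (deriv Λ) (Ioo 0 e') ∧ ∀ x ∈ Ioo (0 : ℝ) e', deriv Λ x < 0 :=
  ⟨(differentiableOn_dynAbel hB hCm hθ0 hθ1 hbs hta hts htf hprof hG hGB hΛ h2e' hs1 hs2 hs4 hs5).2,
    deriv_dynAbel_continuousOn hB hCm hθ0 hθ1 hbs hta hts htf hprof hG hGB hGc hΛ h2e' hs1 hs2 hs4 hs5,
    fun _ hx => (differentiableAt_dynAbel hB hCm hθ0 hθ1 hbs hta hts htf hprof hG hGB hΛ h2e' hs1 hs2 hs4 hs5 hx).2.1⟩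

end

end Summit.QuantumFields.BalabanUV.Beta.EriceFlowEnclosureB12AsPrintedHistoryContagionShiftFlowZeroTangentSmooth
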